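import Summits.AtomisticToContinuum.FouriersLaw.Theorems.BondHeatUncertaintyBoundedResponseEnergyFluctuationB
import HarnessLib

/-!
# `BondHeatUncertainty.BoundedResponse` — (V) `EnergyFluctuationExtensive` PROVED, FINAL PART of three (lens-1 g95, NODE 95E storage grade)

FINAL PART: §V.5 (phase space: `hamiltonian_eq_kin_add_potEnergy`, `integrable_gibbs_of_abs_le`, the `q`-marginal
`integral_comp_fst_gibbsMeasure`) and §V.6 `theorem energyFluctuationExtensive_holds : EnergyFluctuationExtensive`.
See PART A (`…Theorems.BondHeatUncertaintyBoundedResponseEnergyFluctuationA`) for the full statement, the constant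
`C = T² + (T/ω₂)·3K₀(1 + T/ω₂ + 90(T/ω₂)³)`, `K₀ = 6(ω₂² + λ²) + 24 + 384β²`, and the proof outline §V.1–§V.6 (Brascamp–Lieb moment
ladder in position space + `q`-marginal + kinetic covariance; no integration by parts).  Bodies verbatim from the verified single file
(sha256 951a9e83…, critic row 1357); 0 sorry; standard axioms; every declaration carries a docstring.
Landing form (hand-2 lane): `--supports stmt-AtomisticToContinuum-11071`.
-/

noncomputable section

open MeasureTheory ProbabilityTheory Filter Topology Set Function
open scoped NNReal ENNReal ContDiff RealInnerProductSpace
open Literature.MathematicalPhysics.KineticTheory.HeatConduction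
open Literature.MathematicalPhysics.KineticTheory OscillatorChain

namespace Summit.AtomisticToContinuum.FouriersLaw.Theorems.BoundedResponse.ParityFloor

section EnergyFluctuation

variable {ω₂ lam β γ T : ℝ}

/-! ### §V.5 Phase space: the `q`-marginal, the kinetic covariance, and the assembly -/

section Phase

variable {N : ℕ}

/-- `H(q,p) = ∑ᵢ pᵢ²/2 + U_N(q)` for the pinned chain with any coupling `γ`. [folklore] -/
theorem hamiltonian_eq_kin_add_potEnergy (x : PhaseSpace N) :
    (pinnedChain ω₂ lam β γ).hamiltonian N x = (∑ i, x.2 i ^ 2 / 2) + potEnergy ω₂ lam β N x.1 := by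
  have h0 : potEnergy ω₂ lam β N x.1 = (pinnedChain ω₂ lam β γ).potential N x.1 := by
    unfold potEnergy
    rw [OscillatorChain.hamiltonian_eq_kinetic_add_potential]
    simp [OscillatorChain.potential, pinnedChain]
  rw [h0, OscillatorChain.hamiltonian_eq_kinetic_add_potential]

/-- `U_N(q) ≤ H(q,p)`. [folklore] -/
theorem potEnergy_fst_le_hamiltonian (x : PhaseSpace N) :
    potEnergy ω₂ lam β N x.1 ≤ (pinnedChain ω₂ lam β γ).hamiltonian N x := by
  rw [hamiltonian_eq_kin_add_potEnergy]
  have : 0 ≤ ∑ i, x.2 i ^ 2 / 2 := Finset.sum_nonneg fun i _ => by positivity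
  linarith

/-- A continuous observable dominated by `A·e^{ϑH}` with `ϑ < 1/T` is `μ_T`-integrable. [folklore] -/
theorem integrable_gibbs_of_abs_le (hω : 0 < ω₂) (hl : 0 ≤ lam) (hβ : 0 ≤ β) (hT : 0 < T) {ϑ A : ℝ}
    (hϑ : ϑ < 1 / T) {g : PhaseSpace N → ℝ} (hg : Continuous g)
    (hb : ∀ x, |g x| ≤ A * Real.exp (ϑ * (pinnedChain ω₂ lam β γ).hamiltonian N x)) :
    Integrable g ((pinnedChain ω₂ lam β γ).gibbsMeasure N T) :=
  ((pinnedChain_integrable_exp_mul_hamiltonian_gibbsMeasure hω hl hβ γ N hT hϑ).const_mul A).mono'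
    hg.aestronglyMeasurable (Eventually.of_forall fun x => by rw [Real.norm_eq_abs]; exact hb x)

/-- **The `q`-marginal of the Gibbs measure is `w/Z`**: `∫ g(q) dμ_T(q,p) = (∫ g w)/(∫ w)` for every `g` (product
structure of `e^{-H/T} = w(q)·e^{-|p|²/(2T)}`; no integrability needed, both sides share junk values). [folklore] -/
theorem integral_comp_fst_gibbsMeasure (hT : 0 < T) (g : (Fin N → ℝ) → ℝ) :
    ∫ x, g x.1 ∂((pinnedChain ω₂ lam β γ).gibbsMeasure N T) =
      (∫ q, g q * potWeight ω₂ lam β T N q) / ∫ q, potWeight ω₂ lam β T N q := by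
  set P := pinnedChain ω₂ lam β γ with hP
  set k : (Fin N → ℝ) → ℝ := fun p => Real.exp (-((∑ i, p i ^ 2 / 2) / T)) with hk
  have hρ : ∀ x : PhaseSpace N, P.gibbsDensity N T x = potWeight ω₂ lam β T N x.1 * k x.2 := fun x => by
    simp only [OscillatorChain.gibbsDensity, potWeight, hk, ← Real.exp_add, hP, hamiltonian_eq_kin_add_potEnergy]
    congr 1
    ring
  have hk_int : Integrable k := by
    have hp : Integrable (fun p : Fin N → ℝ => ∏ i, Real.exp (-(1 / (2 * T)) * p i ^ 2)) := by
      have := Integrable.fintype_prod (μ := fun _ : Fin N => (volume : Measure ℝ))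
        (f := fun _ t => Real.exp (-(1 / (2 * T)) * t ^ 2))
        (fun _ => integrable_exp_neg_mul_sq (by positivity))
      simpa [volume_pi] using this
    refine hp.congr (Eventually.of_forall fun p => ?_)
    simp only [hk, ← Real.exp_sum]
    congr 1
    rw [Finset.sum_div, ← Finset.sum_neg_distrib]
    exact Finset.sum_congr rfl fun i _ => by ring
  have hk_pos : 0 < ∫ p, k p := integral_exp_pos hk_int
  have e1 : ∫ x : PhaseSpace N, g x.1 * P.gibbsDensity N T x =
      (∫ q, g q * potWeight ω₂ lam β T N q) * ∫ p, k p := by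
    simp_rw [hρ, ← mul_assoc]
    rw [Measure.volume_eq_prod]
    exact integral_prod_mul (fun q => g q * potWeight ω₂ lam β T N q) k
  have e2 : ∫ x : PhaseSpace N, P.gibbsDensity N T x = (∫ q, potWeight ω₂ lam β T N q) * ∫ p, k p := by
    simp_rw [hρ]
    rw [Measure.volume_eq_prod]
    exact integral_prod_mul (potWeight ω₂ lam β T N) k
  rw [OscillatorChain.integral_gibbsMeasure, e1, e2, mul_inv, div_eq_inv_mul]
  field_simp

end Phase

/-! ### §V.6 The theorem -/

/-- **(V) `EnergyFluctuationExtensive` holds**: `Var_{μ_T}(H_N) ≤ (T² + (T/ω₂)K₁)·N` with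
`K₁ = 3K₀(1 + T/ω₂ + 90(T/ω₂)³)`, `K₀ = 6(ω₂² + λ²) + 24 + 384β²`.  Proof: `Var H = ⟨H̃·½∑θᵢ⟩ + ⟨H̃·(U − m_U)⟩`,
the first term is `N T²/2` (`integral_kinObs_mul_hamiltonian`), the second `≤ ½Var H + ½Var(U∘fst)`, and
`Var(U∘fst) ≤ (T/ω₂)K₁N` by the `q`-marginal and `potFluct_le`. [cite: BrascampLieb1976, Thm 4.1] -/
theorem energyFluctuationExtensive_holds : EnergyFluctuationExtensive := by
  intro ω₂ lam β γ hω hl hβ hγ T hT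
  set K₁ : ℝ := 3 * gradConst ω₂ lam β * (1 + T / ω₂ + 90 * (T / ω₂) ^ 3) with hK₁
  refine ⟨T ^ 2 + T / ω₂ * K₁, fun N => ?_⟩
  set P := pinnedChain ω₂ lam β γ with hP
  set μ := P.gibbsMeasure N T with hμ
  haveI : IsProbabilityMeasure μ := pinnedChain_isProbabilityMeasure_gibbsMeasure hω hl.le hβ.le γ N hT
  have hK₁0 : 0 ≤ K₁ := by
    have := gradConst_nonneg (ω₂ := ω₂) (lam := lam) (β := β)
    have := div_pos hT hω
    positivity
  rcases Nat.eq_zero_or_pos N with hN0 | hN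
  · subst hN0
    have hH : ∀ z : PhaseSpace 0, P.hamiltonian 0 z = 0 := fun z => by
      simp [hP, OscillatorChain.hamiltonian]
    simp [hH]
  set m : ℝ := ∫ x, P.hamiltonian N x ∂μ with hm
  obtain ⟨hϑ0, h2ϑ, hϑ1⟩ := weight_facts hT
  obtain ⟨-, hHm_b, iHm_sq⟩ := centredHamiltonian_facts hω hl.le hβ hγ hN hT
  rw [← hP, ← hμ, ← hm] at hHm_b iHm_sq
  set ϑ : ℝ := 1 / (4 * T) with hϑ
  set U : (Fin N → ℝ) → ℝ := potEnergy ω₂ lam β N with hU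
  set w : (Fin N → ℝ) → ℝ := potWeight ω₂ lam β T N with hw
  set Z : ℝ := ∫ q, w q with hZ
  set mU : ℝ := (∫ q, U q * w q) / Z with hmU
  have hZ0 : 0 < Z := integral_potWeight_pos hω hl.le hβ.le hT
  -- pointwise facts
  have hH0 : ∀ x, 0 ≤ P.hamiltonian N x := fun x => pinnedChain_hamiltonian_nonneg hω.le hl.le hβ.le γ N x
  have hHc : Continuous (P.hamiltonian N) := pinnedChain_continuous_hamiltonian ω₂ lam β γ N
  have hHe : ∀ x, P.hamiltonian N x ≤ Real.exp (ϑ * P.hamiltonian N x) / ϑ := fun x =>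
    IncoherentBounded.hamiltonian_le_exp (γ := γ) hϑ0 x
  have hee : ∀ x, Real.exp (ϑ * P.hamiltonian N x) * Real.exp (ϑ * P.hamiltonian N x) =
      Real.exp (2 * ϑ * P.hamiltonian N x) := fun x => by rw [← Real.exp_add]; ring_nf
  have he1 : ∀ x, 1 ≤ Real.exp (ϑ * P.hamiltonian N x) := fun x =>
    Real.one_le_exp (mul_nonneg hϑ0.le (hH0 x))
  have hU0 : ∀ x : PhaseSpace N, 0 ≤ U x.1 := fun x => potEnergy_nonneg hω.le hl.le hβ.le x.1
  have hUH : ∀ x : PhaseSpace N, U x.1 ≤ P.hamiltonian N x := fun x => potEnergy_fst_le_hamiltonian x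
  have hUc : Continuous fun x : PhaseSpace N => U x.1 - mU :=
    (continuous_potEnergy.comp continuous_fst).sub continuous_const
  have hUb : ∀ x : PhaseSpace N, |U x.1 - mU| ≤ (1 / ϑ + |mU|) * Real.exp (ϑ * P.hamiltonian N x) :=
    fun x => by
    calc |U x.1 - mU| ≤ |U x.1| + |mU| := abs_sub _ _
      _ = U x.1 + |mU| := by rw [abs_of_nonneg (hU0 x)]
      _ ≤ Real.exp (ϑ * P.hamiltonian N x) / ϑ + |mU| * Real.exp (ϑ * P.hamiltonian N x) :=
          add_le_add ((hUH x).trans (hHe x)) (le_mul_of_one_le_right (abs_nonneg _) (he1 x))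
      _ = _ := by ring
  have hθc : ∀ i, Continuous (kinObs T N i) := fun i => continuous_kinObs T i
  have hθb : ∀ i x, |kinObs T N i x| ≤ (2 / ϑ + T) * Real.exp (ϑ * P.hamiltonian N x) := fun i x =>
    abs_kinObs_le (γ := γ) hω hl.le hβ.le hT.le hϑ0 i x
  have hHmc : Continuous fun x => P.hamiltonian N x - m := hHc.sub continuous_const
  -- integrability on μ
  have iH : Integrable (P.hamiltonian N) μ :=
    integrable_gibbs_of_abs_le hω hl.le hβ.le hT hϑ1 hHc (A := 1 / ϑ) (fun x => by
      rw [abs_of_nonneg (hH0 x)]; have := hHe x; rw [div_eq_inv_mul] at this; simpa [one_div] using this)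
  have iθ : ∀ i, Integrable (kinObs T N i) μ := fun i =>
    integrable_gibbs_of_abs_le hω hl.le hβ.le hT hϑ1 (hθc i) (hθb i)
  have iθH : ∀ i, Integrable (fun x => kinObs T N i x * P.hamiltonian N x) μ := fun i =>
    integrable_gibbs_of_abs_le hω hl.le hβ.le hT h2ϑ ((hθc i).mul hHc) (A := (2 / ϑ + T) * (1 / ϑ))
      (fun x => by
        rw [abs_mul, abs_of_nonneg (hH0 x)]
        calc |kinObs T N i x| * P.hamiltonian N x
            ≤ (2 / ϑ + T) * Real.exp (ϑ * P.hamiltonian N x) * (Real.exp (ϑ * P.hamiltonian N x) / ϑ) :=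
              mul_le_mul (hθb i x) (hHe x) (hH0 x) (by positivity)
          _ = (2 / ϑ + T) * (1 / ϑ) * Real.exp (2 * ϑ * P.hamiltonian N x) := by rw [← hee x]; ring)
  have iHθ : ∀ i, Integrable (fun x => (P.hamiltonian N x - m) * kinObs T N i x) μ := fun i =>
    integrable_gibbs_of_abs_le hω hl.le hβ.le hT h2ϑ (hHmc.mul (hθc i)) (A := (1 / ϑ + |m|) * (2 / ϑ + T))
      (fun x => by
        rw [abs_mul]
        calc |P.hamiltonian N x - m| * |kinObs T N i x|
            ≤ (1 / ϑ + |m|) * Real.exp (ϑ * P.hamiltonian N x) * ((2 / ϑ + T) * Real.exp (ϑ * P.hamiltonian N x)) :=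
              mul_le_mul (hHm_b x) (hθb i x) (abs_nonneg _) (by positivity)
          _ = (1 / ϑ + |m|) * (2 / ϑ + T) * Real.exp (2 * ϑ * P.hamiltonian N x) := by rw [← hee x]; ring)
  have iHU : Integrable (fun x => (P.hamiltonian N x - m) * (U x.1 - mU)) μ :=
    integrable_gibbs_of_abs_le hω hl.le hβ.le hT h2ϑ (hHmc.mul hUc) (A := (1 / ϑ + |m|) * (1 / ϑ + |mU|))
      (fun x => by
        rw [abs_mul]
        calc |P.hamiltonian N x - m| * |U x.1 - mU|
            ≤ (1 / ϑ + |m|) * Real.exp (ϑ * P.hamiltonian N x) * ((1 / ϑ + |mU|) * Real.exp (ϑ * P.hamiltonian N x)) :=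
              mul_le_mul (hHm_b x) (hUb x) (abs_nonneg _) (by positivity)
          _ = (1 / ϑ + |m|) * (1 / ϑ + |mU|) * Real.exp (2 * ϑ * P.hamiltonian N x) := by rw [← hee x]; ring)
  have iU_sq : Integrable (fun x : PhaseSpace N => (U x.1 - mU) ^ 2) μ :=
    integrable_gibbs_of_abs_le hω hl.le hβ.le hT h2ϑ (hUc.pow 2) (A := (1 / ϑ + |mU|) ^ 2)
      (fun x => by
        rw [abs_of_nonneg (sq_nonneg _), ← sq_abs]
        calc |U x.1 - mU| ^ 2 ≤ ((1 / ϑ + |mU|) * Real.exp (ϑ * P.hamiltonian N x)) ^ 2 :=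
              pow_le_pow_left₀ (abs_nonneg _) (hUb x) 2
          _ = (1 / ϑ + |mU|) ^ 2 * Real.exp (2 * ϑ * P.hamiltonian N x) := by rw [← hee x]; ring)
  -- the split `H − m = (∑ θᵢ)/2 + (U − c)`, `c = m − N T/2`
  have hsplit : ∀ x, P.hamiltonian N x - m =
      (∑ i, kinObs T N i x) / 2 + (U x.1 - (m - N * T / 2)) := fun x => by
    rw [hP, hamiltonian_eq_kin_add_potEnergy, ← hU, ← Finset.sum_div]
    simp only [kinObs, Finset.sum_sub_distrib, Finset.sum_const, Finset.card_univ, Fintype.card_fin,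
      nsmul_eq_mul]
    ring
  -- ∫ (H − m) = 0
  have iHm : Integrable (fun x => P.hamiltonian N x - m) μ := iH.sub (integrable_const m)
  have hHm0 : ∫ x, (P.hamiltonian N x - m) ∂μ = 0 := by
    rw [integral_sub iH (integrable_const m), integral_const, smul_eq_mul, hm]
    simp
  -- the product split, pointwise
  have hprod : ∀ x, (P.hamiltonian N x - m) * ((∑ i, kinObs T N i x) / 2) =
      (1 / 2) * ∑ i, (P.hamiltonian N x - m) * kinObs T N i x := fun x => by
    rw [Finset.sum_div, Finset.mul_sum, Finset.mul_sum]
    exact Finset.sum_congr rfl fun i _ => by ring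
  -- I₁: the kinetic covariance
  have hI1 : ∀ i, ∫ x, (P.hamiltonian N x - m) * kinObs T N i x ∂μ = T ^ 2 := fun i => by
    have e : ∀ x, (P.hamiltonian N x - m) * kinObs T N i x =
        kinObs T N i x * P.hamiltonian N x - m * kinObs T N i x := fun x => by ring
    simp_rw [e]
    rw [integral_sub (iθH i) ((iθ i).const_mul m), integral_const_mul]
    have h1 : ∫ x, kinObs T N i x * P.hamiltonian N x ∂μ = T ^ 2 :=
      IncoherentBounded.integral_kinObs_mul_hamiltonian hω hl.le hβ.le hT i
    have h2 : ∫ x, kinObs T N i x ∂μ = 0 := integral_kinObs hω hl.le hβ.le hT i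
    rw [h1, h2, mul_zero, sub_zero]
  have hI1s : ∫ x, (P.hamiltonian N x - m) * ((∑ i, kinObs T N i x) / 2) ∂μ = N * T ^ 2 / 2 := by
    simp_rw [hprod]
    rw [integral_const_mul, integral_finsetSum _ (fun i _ => iHθ i)]
    simp only [hI1, Finset.sum_const, Finset.card_univ, Fintype.card_fin, nsmul_eq_mul]
    ring
  -- I₂: the potential covariance, `≤ ½ Var H + ½ Var U`
  have hI2 : ∫ x, (P.hamiltonian N x - m) * (U x.1 - (m - N * T / 2)) ∂μ =
      ∫ x, (P.hamiltonian N x - m) * (U x.1 - mU) ∂μ := by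
    have e : ∀ x, (P.hamiltonian N x - m) * (U x.1 - (m - N * T / 2)) =
        (P.hamiltonian N x - m) * (U x.1 - mU) + (mU - (m - N * T / 2)) * (P.hamiltonian N x - m) := fun x => by
      ring
    simp_rw [e]
    rw [integral_add iHU (iHm.const_mul _), integral_const_mul, hHm0, mul_zero, add_zero]
  have hI2le : ∫ x, (P.hamiltonian N x - m) * (U x.1 - mU) ∂μ ≤
      (∫ x, (P.hamiltonian N x - m) ^ 2 ∂μ) / 2 + (∫ x, (U x.1 - mU) ^ 2 ∂μ) / 2 := by
    have hle : ∀ x, (P.hamiltonian N x - m) * (U x.1 - mU) ≤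
        ((P.hamiltonian N x - m) ^ 2 + (U x.1 - mU) ^ 2) / 2 := fun x => by
      nlinarith [sq_nonneg ((P.hamiltonian N x - m) - (U x.1 - mU))]
    have iS0 : Integrable (fun x => (P.hamiltonian N x - m) ^ 2 + (U x.1 - mU) ^ 2) μ := iHm_sq.add iU_sq
    have iS : Integrable (fun x => ((P.hamiltonian N x - m) ^ 2 + (U x.1 - mU) ^ 2) / 2) μ := iS0.div_const 2
    have hS : ∫ x, ((P.hamiltonian N x - m) ^ 2 + (U x.1 - mU) ^ 2) / 2 ∂μ =
        (∫ x, (P.hamiltonian N x - m) ^ 2 ∂μ) / 2 + (∫ x, (U x.1 - mU) ^ 2 ∂μ) / 2 := by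
      rw [integral_div, integral_add iHm_sq iU_sq, add_div]
    exact (integral_mono iHU iS hle).trans_eq hS
  -- Var H = I₁ + I₂
  have hVar : ∫ x, (P.hamiltonian N x - m) ^ 2 ∂μ =
      N * T ^ 2 / 2 + ∫ x, (P.hamiltonian N x - m) * (U x.1 - mU) ∂μ := by
    have e : ∀ x, (P.hamiltonian N x - m) ^ 2 =
        (P.hamiltonian N x - m) * ((∑ i, kinObs T N i x) / 2) +
          (P.hamiltonian N x - m) * (U x.1 - (m - N * T / 2)) := fun x => by
      conv_lhs => rw [sq, hsplit x]
      rw [hsplit x]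
      ring
    have iA : Integrable (fun x => (P.hamiltonian N x - m) * ((∑ i, kinObs T N i x) / 2)) μ := by
      have := (integrable_finsetSum (Finset.univ : Finset (Fin N)) (fun i _ => iHθ i)).const_mul (1 / 2)
      exact this.congr (Eventually.of_forall fun x => (hprod x).symm)
    have iB : Integrable (fun x => (P.hamiltonian N x - m) * (U x.1 - (m - N * T / 2))) μ := by
      have := iHU.add (iHm.const_mul (mU - (m - N * T / 2)))
      refine this.congr (Eventually.of_forall fun x => ?_)
      simp only [Pi.add_apply]
      ring
    simp_rw [e]
    rw [integral_add iA iB, hI1s, hI2]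
  -- Var(U∘fst) via the q-marginal and `potFluct_le`
  have hmU' : ∫ x, U x.1 ∂μ = mU := by
    rw [hμ, hP, integral_comp_fst_gibbsMeasure hT]
  have hVarU : ∫ x, (U x.1 - mU) ^ 2 ∂μ ≤ T / ω₂ * ((N : ℝ) * K₁) := by
    rw [hμ, hP, integral_comp_fst_gibbsMeasure hT (fun q => (U q - mU) ^ 2), div_le_iff₀ hZ0]
    have := potFluct_le (N := N) hω hl.le hβ.le hT
    rw [← hU, ← hw, ← hZ, ← hmU, ← hK₁] at this
    linarith [this]
  -- conclusion
  have hfin : ∫ x, (P.hamiltonian N x - m) ^ 2 ∂μ ≤ N * T ^ 2 + T / ω₂ * ((N : ℝ) * K₁) := by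
    linarith [hVar, hI2le, hVarU]
  calc ∫ x, (P.hamiltonian N x - m) ^ 2 ∂μ ≤ N * T ^ 2 + T / ω₂ * ((N : ℝ) * K₁) := hfin
    _ = (T ^ 2 + T / ω₂ * K₁) * N := by ring

end EnergyFluctuation

end Summit.AtomisticToContinuum.FouriersLaw.Theorems.BoundedResponse.ParityFloor

end
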